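import Summits.ABC.ABC.Theorems.TwistAmplificationMazurKaneLawRecordFineDictionary
import Summits.ABC.ABC.Theorems.TwistAmplificationMazurKaneLawRecordDEDefs
import Summits.ABC.ABC.Theorems.TwistAmplificationMazurKaneLawDEDictEntry
import Summits.ABC.ABC.Theorems.TwistAmplificationMazurKaneLawDEToolX
import Summits.ABC.ABC.Theorems.TwistAmplificationMazurKaneLawDEToolZ
-- `Summit.ABC.ABC` is the mandated summit-side namespace (single-conjunct summit); the lakefile sets the same option.
set_option linter.dupNamespace false

/-!
# Crux `TwistAmplification.MazurKaneLaw` (stmt-ABC-2757), line `critical-kloosterman-powerful-moduli`: the J-generic dictionary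
# theorem WITH THE DE FAMILY (record pipeline v3)

`recordInstanceDE_of_lpCertDE`: a proof of the pure-real LP `LpCertDE K J s₀ Vc` (the telescope of `recordInstanceK_of_lp` plus the
three DE families) yields `RecordInstanceDE K J s₀ Vc` (the record-instance fact with the divisor hypothesis up to `8 T³`). The proof
is that of `recordInstanceK_of_lp` (`…RecordFineDictionary.lean`, itself adapted from `recordInstance_of_lp`) — the five fibre-toolkit
families are read through the same linear dictionary (`trivial_linear`, `det_linear`, `fourier_linear`, `geometry_disjunction`,
`sqrtLattice_linear`) after weakening the divisor hypothesis — followed by the three DE families: `de_dispersionToolX` (host `x`; host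
`y` on the swapped datum via `shapeCount_swap`) and `de_dispersionToolZ` (host `z`) feed `dispersion_linear` (`…DEDictEntry.lean`) at the
pivots `Fin.castAdd e i₀, Fin.castAdd e i₁` and the level set `Q.map (Fin.castAddEmb e)`; its eight disjuncts, halved, are the LP's, the
halved loss `(3(J+e)+4) log_Λ Dτ + (log_Λ 4400 + 3 log_Λ 4)/2` being absorbed by the slack (`≤ (12(J+e)+3J+10) log_Λ Dτ + log_Λ 27 +
log_Λ 48 ≤ σ`).
-/

noncomputable section

open Finset
open Literature.NumberTheory.DiophantineGeometry
open Literature.NumberTheory.DiophantineGeometry.AbcShapes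

namespace Summit.ABC.ABC.Theorems.MazurKaneLaw

open Summit.ABC.ABC.Theorems.MazurKaneLaw.Toolkit

/-- **The J-generic dictionary theorem with the DE family** (registered sub-goal `recordInstanceDE_of_lpCertDE` of crux stmt-ABC-2757):
`LpCertDE K J s₀ Vc → RecordInstanceDE K J s₀ Vc` for `J ≥ 1`. Pattern: `recordInstanceK_of_lp`. -/
theorem recordInstanceDE_of_lpCertDE : ∀ (K : ℝ) (J : ℕ) (s₀ Vc : ℝ), 1 ≤ J → Summit.ABC.ABC.Theorems.MazurKaneLaw.Toolkit.LpCertDE K J s₀ Vc → Summit.ABC.ABC.Theorems.MazurKaneLaw.Toolkit.RecordInstanceDE K J s₀ Vc := by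
  -- adapted from `recordInstanceK_of_lp` (TwistAmplificationMazurKaneLawRecordFineDictionary.lean): same dictionary, strong divisor
  -- hypothesis weakened for the five old families, plus the three DE families at the end
  intro K J s₀ Vc hJ hlp e c₁ c₂ c₃ C₀ hc₁ hc₂ hc₃ hC₀ X Y Z hX hY hZ T Dτ hTX hTY hTZ hD8 hC₀le hvX hvY hvZ t hP
    hB0 P₀ hP₀ hdet hQX hQZ hσm
  classical
  dsimp only [LpCertDE] at hlp
  /- the weak divisor hypothesis (up to `T`) from the strong one (up to `8 T³`) -/
  have hT1 : 1 ≤ T := le_trans (Nat.mul_pos hc₃ (shapeVal_pos fun i => Nat.mul_pos two_pos (hZ i))) hTZ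
  have hT8 : T ≤ 8 * T ^ 3 :=
    calc T = T * 1 * 1 := by ring
      _ ≤ T * T * T := by gcongr
      _ = T ^ 3 := by ring
      _ ≤ 8 * T ^ 3 := Nat.le_mul_of_pos_left _ (by norm_num)
  have hD : ∀ m : ℕ, m ≠ 0 → m ≤ T → m.divisors.card ≤ Dτ := fun m hm hmT => hD8 m hm (hmT.trans hT8)
  obtain ⟨Λ, hΛdef⟩ : ∃ Λ : ℝ, Λ = 2 * C₀ := ⟨_, rfl⟩
  rw [← hΛdef] at hP hσm ⊢
  obtain ⟨σ, hσdef⟩ : ∃ σ : ℝ, recordSlack J (J + e) Λ Dτ P₀ t s₀ = σ := ⟨_, rfl⟩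
  rw [hσdef] at hσm ⊢
  /- positivity of the scale and of the loss terms; the slack -/
  have hC₀' : (1 : ℝ) ≤ C₀ := by exact_mod_cast hC₀
  have hΛ : 1 < Λ := by rw [hΛdef]; linarith only [hC₀']
  have hΛ0 : 0 < Λ := by linarith only [hΛ]
  have hDτ : 1 ≤ Dτ := by
    have h1 : (1 : ℕ) ≤ T :=
      le_trans (Nat.mul_pos hc₃ (shapeVal_pos fun i => Nat.mul_pos two_pos (hZ i))) hTZ
    simpa using hD 1 one_ne_zero h1
  have hBr : (0 : ℝ) < shapeCount c₁ c₂ c₃ X Y Z := by exact_mod_cast hB0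
  have he0 : (0 : ℝ) ≤ (e : ℝ) := Nat.cast_nonneg _
  have hJ1 : (1 : ℝ) ≤ (J : ℝ) := by exact_mod_cast hJ
  have hdd : ((J + e : ℕ) : ℝ) = (J : ℝ) + (e : ℝ) := Nat.cast_add J e
  have hlD0 : 0 ≤ Real.logb Λ Dτ := Real.logb_nonneg hΛ (by exact_mod_cast hDτ)
  have hV2pos : 0 < shapeVal (fun _ : Fin (J + e) => 2) := shapeVal_pos fun _ => two_pos
  have hlV0 : 0 ≤ Real.logb Λ ((shapeVal (fun _ : Fin (J + e) => 2) : ℕ) : ℝ) :=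
    Real.logb_nonneg hΛ (by exact_mod_cast Nat.one_le_iff_ne_zero.mpr hV2pos.ne')
  obtain ⟨hl20, hl27, hl48, hl114⟩ : 0 ≤ Real.logb Λ 2 ∧ 0 ≤ Real.logb Λ 27 ∧ 0 ≤ Real.logb Λ 48 ∧
      0 ≤ Real.logb Λ 114 := by
    refine ⟨?_, ?_, ?_, ?_⟩ <;> exact Real.logb_nonneg hΛ (by norm_num)
  have hl24 : 0 ≤ Real.logb Λ (24 * (J : ℝ) * ((J : ℝ) + 1)) :=
    Real.logb_nonneg hΛ (by nlinarith only [hJ1])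
  have hlP0 : 0 ≤ Real.logb Λ P₀ := Real.logb_nonneg hΛ hP₀
  obtain ⟨m, hmdef⟩ : ∃ m : ℝ, max (t - s₀) 0 = m := ⟨_, rfl⟩
  have hmax0 : 0 ≤ m := by rw [← hmdef]; exact le_max_right _ _
  have hmax1 : t - s₀ ≤ m := by rw [← hmdef]; exact le_max_left _ _
  have hσ' : σ = (12 * ((J : ℝ) + e) + 3 * J + 10) * Real.logb Λ Dτ + ((J : ℝ) ^ 2 + J + 10) * Real.logb Λ 2 +
      Real.logb Λ ((shapeVal (fun _ : Fin (J + e) => 2) : ℕ) : ℝ) + Real.logb Λ 27 + Real.logb Λ 48 +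
      Real.logb Λ 114 + Real.logb Λ (24 * (J : ℝ) * ((J : ℝ) + 1)) + Real.logb Λ P₀ + m := by
    rw [← hσdef, recordSlack, hmdef, hdd]
  have hKD0 : 0 ≤ (12 * ((J : ℝ) + e) + 3 * J + 10) * Real.logb Λ Dτ :=
    mul_nonneg (by linarith only [he0, hJ1]) hlD0
  have hK20 : 0 ≤ ((J : ℝ) ^ 2 + J + 10) * Real.logb Λ 2 := mul_nonneg (by positivity) hl20
  have hK2 : Real.logb Λ 2 ≤ ((J : ℝ) ^ 2 + J + 10) * Real.logb Λ 2 :=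
    le_mul_of_one_le_left hl20 (by nlinarith only [hJ1])
  have hσ0 : 0 ≤ σ := by rw [hσ']; linarith only [hKD0, hK20, hlV0, hl27, hl48, hl114, hl24, hlP0, hmax0]
  /- the first `J` coordinates `Fin.castAdd e k`, `k < J` -/
  have hcast1 : ∀ {k : Fin J}, 1 ≤ (k : ℕ) → 1 ≤ ((Fin.castAdd e k : Fin (J + e)) : ℕ) := fun hk => by
    rwa [Fin.val_castAdd]
  have hkJ : ∀ k : Fin J, ((k : ℕ) : ℝ) + 1 ≤ (J : ℝ) := fun k => by exact_mod_cast Nat.succ_le_of_lt k.is_lt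
  /- the LP variables: exponents `α, β, γ`, totals `A, B, C`, `D`, deficits `da, db, dc`; the structure -/
  obtain ⟨α, hα⟩ : ∃ f : Fin (J + e) → ℝ, expo Λ X = f := ⟨_, rfl⟩
  obtain ⟨β, hβ⟩ : ∃ f : Fin (J + e) → ℝ, expo Λ Y = f := ⟨_, rfl⟩
  obtain ⟨γ, hγ⟩ : ∃ f : Fin (J + e) → ℝ, expo Λ Z = f := ⟨_, rfl⟩
  obtain ⟨A, hA⟩ : ∃ r : ℝ, ∑ i, α i = r := ⟨_, rfl⟩
  obtain ⟨B, hB⟩ : ∃ r : ℝ, ∑ i, β i = r := ⟨_, rfl⟩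
  obtain ⟨C, hC⟩ : ∃ r : ℝ, ∑ i, γ i = r := ⟨_, rfl⟩
  obtain ⟨D, hDn⟩ : ∃ r : ℝ, Real.logb Λ (shapeCount c₁ c₂ c₃ X Y Z) = r := ⟨_, rfl⟩
  obtain ⟨da, hLX⟩ : ∃ r : ℝ, Real.logb Λ ((c₁ * shapeVal X : ℕ) : ℝ) = 1 - r := ⟨_, (sub_sub_cancel 1 _).symm⟩
  obtain ⟨db, hLY⟩ : ∃ r : ℝ, Real.logb Λ ((c₂ * shapeVal Y : ℕ) : ℝ) = 1 - r := ⟨_, (sub_sub_cancel 1 _).symm⟩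
  obtain ⟨dc, hLZ⟩ : ∃ r : ℝ, Real.logb Λ ((c₃ * shapeVal Z : ℕ) : ℝ) = 1 - r := ⟨_, (sub_sub_cancel 1 _).symm⟩
  have hLrad : radExp Λ X Y Z = A + B + C := by
    rw [radExp, sum_add_distrib, sum_add_distrib, hα, hβ, hγ, hA, hB, hC]
  have hdefic : deficiency Λ c₁ c₂ c₃ X Y Z = da + db + dc := by rw [deficiency, hLX, hLY, hLZ]; ring
  obtain ⟨hα0, hTa, hda0, hda1, hWa⟩ := term_facts_castAdd hc₁ hX hΛ hΛdef hvX hα hA hLX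
  obtain ⟨hβ0, hTb, hdb0, hdb1, hWb⟩ := term_facts_castAdd hc₂ hY hΛ hΛdef hvY hβ hB hLY
  obtain ⟨hγ0, hTc, hdc0, -, hWc⟩ := term_facts_castAdd hc₃ hZ hΛ hΛdef hvZ hγ hC hLZ
  -- `dc ≤ σ`: `C₀ ≤ V₂ · c₃ shapeVal Z` and `log_Λ C₀ = 1 − log_Λ 2`
  have hdcσ : dc ≤ σ := by
    have h3 : Real.logb Λ (C₀ : ℝ) ≤ Real.logb Λ ((shapeVal (fun _ : Fin (J + e) => 2) : ℕ) : ℝ) +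
        Real.logb Λ ((c₃ * shapeVal Z : ℕ) : ℝ) := by
      rw [← logb_natMul hV2pos (Nat.mul_pos hc₃ (shapeVal_pos hZ))]
      exact logb_natMono hΛ (by omega) hC₀le
    have h4 : Real.logb Λ (C₀ : ℝ) = 1 - Real.logb Λ 2 := by
      have : (C₀ : ℝ) = Λ / 2 := by rw [hΛdef]; ring
      rw [this, Real.logb_div hΛ0.ne' two_ne_zero, Real.logb_self_eq_one hΛ]
    rw [hLZ] at h3
    linarith only [h3, h4, hσ', hKD0, hK2, hlV0, hl27, hl48, hl114, hl24, hlP0, hmax0]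
  /- the radical: `A + B + C = log_Λ ∏ XᵢYᵢZᵢ ≤ t ≤ s₀ + (t − s₀)₊` -/
  have hL : A + B + C ≤ s₀ + σ := by
    have hp : ∀ i, (0 : ℝ) < X i ∧ (0 : ℝ) < Y i ∧ (0 : ℝ) < Z i := fun i =>
      ⟨by exact_mod_cast hX i, by exact_mod_cast hY i, by exact_mod_cast hZ i⟩
    have hpos : ∀ i, (0 : ℝ) < (X i : ℝ) * Y i * Z i := fun i => by obtain ⟨h1, h2, h3⟩ := hp i; positivity
    have hlog := Real.logb_le_logb_of_le hΛ (prod_pos fun i _ => hpos i) hP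
    rw [Real.logb_rpow hΛ0 hΛ.ne', Real.logb_prod _ _ fun i _ => (hpos i).ne'] at hlog
    have hsum : ∑ i, Real.logb Λ ((X i : ℝ) * Y i * Z i) = A + B + C := by
      rw [← hLrad, radExp]
      refine sum_congr rfl fun i _ => ?_
      obtain ⟨h1, h2, h3⟩ := hp i
      rw [Real.logb_mul (by positivity) h3.ne', Real.logb_mul h1.ne' h2.ne']; rfl
    linarith only [hlog, hsum, hmax1, hσ', hKD0, hK20, hlV0, hl27, hl48, hl114, hl24, hlP0]
  /- the trivial family -/
  obtain ⟨hT1, hT2, hT3⟩ := trivial_linear hc₁ hc₂ hc₃ hX hY hZ hTX hTY hTZ hD hΛ hB0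
  have hd1 : ((J : ℝ) + (e : ℝ)) * Real.logb Λ Dτ ≤ (12 * ((J : ℝ) + e) + 3 * J + 10) * Real.logb Λ Dτ :=
    mul_le_mul_of_nonneg_right (by linarith only [he0, hJ1]) hlD0
  have h_T_ab : D ≤ A + B + σ := by
    rw [hα, hβ, hA, hB, hDn, hdd] at hT1
    linarith only [hT1, hd1, hσ', hK20, hlV0, hl27, hl48, hl114, hl24, hlP0, hmax0]
  have h_T_ac : D ≤ A + C + σ := by
    rw [hα, hγ, hA, hC, hDn, hdd] at hT2
    linarith only [hT2, hd1, hσ', hK20, hlV0, hl27, hl48, hl114, hl24, hlP0, hmax0]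
  have h_T_bc : D ≤ B + C + σ := by
    rw [hβ, hγ, hB, hC, hDn, hdd] at hT3
    linarith only [hT3, hd1, hσ', hK20, hlV0, hl27, hl48, hl114, hl24, hlP0, hmax0]
  /- the determinant family at the coordinates `Fin.castAdd e k`, `1 ≤ k < J` -/
  have hDt : ∀ k : Fin J, 1 ≤ (k : ℕ) →
      D ≤ A + B + C - (α (Fin.castAdd e k) + β (Fin.castAdd e k) + γ (Fin.castAdd e k)) + σ ∨
        D ≤ A + B + C - 1 + ((((k : ℕ) : ℝ) - 1) * (α (Fin.castAdd e k) + β (Fin.castAdd e k) +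
          γ (Fin.castAdd e k)) + (da + db + dc)) / 3 + σ := by
    intro k hk
    have h := det_linear hc₁ hc₂ hc₃ hX hY hZ hDτ hΛ hB0 (Fin.castAdd e k) (hdet (Fin.castAdd e k) (hcast1 hk))
    rw [hLrad, hdefic, hDn, hα, hβ, hγ, Fin.val_castAdd] at h
    have hprod : (((k : ℕ) : ℝ) + 1) * (((k : ℕ) : ℝ) + 2) ≤ (J : ℝ) * ((J : ℝ) + 1) :=
      mul_le_mul (hkJ k) (by linarith only [hkJ k]) (by positivity) (by linarith only [hJ1])
    have hl : Real.logb Λ (24 * ((((k : ℕ) : ℝ) + 1) * (((k : ℕ) : ℝ) + 2))) ≤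
        Real.logb Λ (24 * (J : ℝ) * ((J : ℝ) + 1)) :=
      Real.logb_le_logb_of_le hΛ (by positivity) (by linarith only [hprod])
    have hk' : (3 * ((k : ℕ) : ℝ) + 6) * Real.logb Λ Dτ ≤ (12 * ((J : ℝ) + e) + 3 * J + 10) * Real.logb Λ Dτ :=
      mul_le_mul_of_nonneg_right (by linarith only [hkJ k, he0, hJ1]) hlD0
    exact h.imp (fun h => by linarith only [h, hl, hk', hσ', hK20, hlV0, hl27, hl48, hl114, hlP0, hmax0])
      fun h => by linarith only [h, hl, hk', hσ', hK20, hlV0, hl27, hl48, hl114, hlP0, hmax0]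
  /- the Fourier family: saved finsets mapped along `Fin.castAdd e` -/
  have hmapd : ∀ {S : Finset (Fin J)} {n : ℕ}, (∀ k ∈ S, n ∣ (k : ℕ) + 1) →
      ∀ i ∈ S.map (Fin.castAddEmb e), n ∣ (i : ℕ) + 1 := by
    intro S n hS i hi
    rw [mem_map] at hi
    obtain ⟨k, hk, rfl⟩ := hi
    rw [Fin.castAddEmb_apply, Fin.val_castAdd]
    exact hS k hk
  have hF : ∀ (SU SV SW : Finset (Fin J)) (eU eV eW : ℕ), 2 ≤ eU → 2 ≤ eV → 2 ≤ eW →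
      (∀ k ∈ SU, eU ∣ (k : ℕ) + 1) → (∀ k ∈ SV, eV ∣ (k : ℕ) + 1) → (∀ k ∈ SW, eW ∣ (k : ℕ) + 1) →
      ∑ k ∈ SU, α (Fin.castAdd e k) + ∑ k ∈ SV, β (Fin.castAdd e k) + ∑ k ∈ SW, γ (Fin.castAdd e k) ≤
        4 * (A + B + C) - 6 * D + σ := by
    intro SU SV SW eU eV eW heU heV heW hSU hSV hSW
    have h := fourier_linear hc₁ hc₂ hc₃ hX hY hZ hTX hTY hTZ hD hΛ hB0 (SU.map (Fin.castAddEmb e))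
      (SV.map (Fin.castAddEmb e)) (SW.map (Fin.castAddEmb e)) heU heV heW (hmapd hSU) (hmapd hSV) (hmapd hSW)
    rw [hdd, hα, hβ, hγ, hA, hB, hC, hDn] at h
    simp only [sum_map, Fin.castAddEmb_apply] at h
    have h3 : (12 * ((J : ℝ) + e) + 3) * Real.logb Λ Dτ ≤ (12 * ((J : ℝ) + e) + 3 * J + 10) * Real.logb Λ Dτ :=
      mul_le_mul_of_nonneg_right (by linarith only [hJ1]) hlD0
    linarith only [h, h3, hσ', hK20, hlV0, hl48, hl114, hl24, hlP0, hmax0]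
  /- the subset geometry-of-numbers family: index finsets mapped along `Fin.castAdd e`, weights `≤ J(J+1)/2` each -/
  have hG : ∀ (I J' K : Finset (Fin J)),
      ∑ k ∈ I, α (Fin.castAdd e k) + ∑ k ∈ J', β (Fin.castAdd e k) + ∑ k ∈ K, γ (Fin.castAdd e k) ≤
          A + B + C - D + σ ∨
        1 - (∑ k ∈ I, ((k : ℕ) : ℝ) * α (Fin.castAdd e k) + ∑ k ∈ J', ((k : ℕ) : ℝ) * β (Fin.castAdd e k) +
          ∑ k ∈ K, ((k : ℕ) : ℝ) * γ (Fin.castAdd e k)) ≤ A + B + C - D + σ := by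
    intro I J' K
    have g := geometry_disjunction hc₁ hc₂ hc₃ hX hY hZ hTX hTY hTZ hD hΛ hB0 hC₀ hΛdef hC₀le
      (I.map (Fin.castAddEmb e)) (J'.map (Fin.castAddEmb e)) (K.map (Fin.castAddEmb e)) le_rfl
    rw [hdd, hα, hβ, hγ, hA, hB, hC, hDn] at g
    simp only [sum_map, Fin.castAddEmb_apply, Fin.val_castAdd] at g
    have hI := sum_natCast_succ_le I
    have hJ' := sum_natCast_succ_le J'
    have h2 : (8 + ∑ k ∈ I, (((k : ℕ) : ℝ) + 1) + ∑ k ∈ J', (((k : ℕ) : ℝ) + 1)) * Real.logb Λ 2 ≤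
        ((J : ℝ) ^ 2 + J + 10) * Real.logb Λ 2 :=
      mul_le_mul_of_nonneg_right (by linarith only [hI, hJ']) hl20
    have h3d : 3 * ((J : ℝ) + e) * Real.logb Λ Dτ ≤ (12 * ((J : ℝ) + e) + 3 * J + 10) * Real.logb Λ Dτ :=
      mul_le_mul_of_nonneg_right (by linarith only [he0, hJ1]) hlD0
    exact g.imp (fun g => by linarith only [g, h2, h3d, hσ', hl27, hl48, hl114, hl24, hlP0, hmax0])
      fun g => by linarith only [g, h2, h3d, hσ', hl27, hl48, hl114, hl24, hlP0, hmax0]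
  /- the square-root lattice family: hosts `x` (tool `Q_X`), `y` (`Q_X` on the swapped datum), `z` (`Q_Z`), host
  finsets mapped along `Fin.castAdd e`; the loss `(d + k + 2) log Dτ + log 114` at `k < J` is `≤ σ` -/
  have hQσ : ∀ {k : Fin J} {L1 L2 : ℝ},
      (D ≤ L1 + (((J : ℝ) + e + (k : ℕ) + 2) * Real.logb Λ Dτ + Real.logb Λ 114) ∨
        D ≤ L2 + (((J : ℝ) + e + (k : ℕ) + 2) * Real.logb Λ Dτ + Real.logb Λ 114)) →
      D ≤ L1 + σ ∨ D ≤ L2 + σ := by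
    intro k L1 L2 h
    have h9 : ((J : ℝ) + e + (k : ℕ) + 2) * Real.logb Λ Dτ ≤ (12 * ((J : ℝ) + e) + 3 * J + 10) * Real.logb Λ Dτ :=
      mul_le_mul_of_nonneg_right (by linarith only [he0, hJ1, hkJ k]) hlD0
    exact h.imp (fun h => by linarith only [h, h9, hσ', hK20, hlV0, hl27, hl48, hl24, hlP0, hmax0])
      fun h => by linarith only [h, h9, hσ', hK20, hlV0, hl27, hl48, hl24, hlP0, hmax0]
  have hQa : ∀ (H : Finset (Fin J)) (k : Fin J), 1 ≤ (k : ℕ) →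
      D ≤ A + B + C - (1 - da) + ∑ j ∈ H, ((j : ℕ) : ℝ) * α (Fin.castAdd e j) + σ ∨
        D ≤ A + B + C - (∑ j ∈ H, α (Fin.castAdd e j) + β (Fin.castAdd e k) + γ (Fin.castAdd e k)) + σ := by
    intro H k hk
    have q := sqrtLattice_linear hc₁ hX hY hZ hDτ hΛ hBr (H.map (Fin.castAddEmb e)) (Fin.castAdd e k)
      (hQX hc₁ hc₂ hc₃ X Y Z hX hY hZ hTX hTY hTZ hD (H.map (Fin.castAddEmb e)) (Fin.castAdd e k) (hcast1 hk))
    rw [hα, hβ, hγ, hA, hB, hC, hDn, hLX, hdd] at q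
    simp only [sum_map, Fin.castAddEmb_apply, Fin.val_castAdd] at q
    exact hQσ q
  have hBr' : (0 : ℝ) < shapeCount c₂ c₁ c₃ Y X Z := by rw [← shapeCount_swap c₁ c₂ c₃ X Y Z]; exact hBr
  have hQb : ∀ (H : Finset (Fin J)) (k : Fin J), 1 ≤ (k : ℕ) →
      D ≤ A + B + C - (1 - db) + ∑ j ∈ H, ((j : ℕ) : ℝ) * β (Fin.castAdd e j) + σ ∨
        D ≤ A + B + C - (∑ j ∈ H, β (Fin.castAdd e j) + α (Fin.castAdd e k) + γ (Fin.castAdd e k)) + σ := by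
    intro H k hk
    have q := sqrtLattice_linear hc₂ hY hX hZ hDτ hΛ hBr' (H.map (Fin.castAddEmb e)) (Fin.castAdd e k)
      (hQX hc₂ hc₁ hc₃ Y X Z hY hX hZ hTY hTX hTZ hD (H.map (Fin.castAddEmb e)) (Fin.castAdd e k) (hcast1 hk))
    rw [← shapeCount_swap c₁ c₂ c₃ X Y Z, hα, hβ, hγ, hA, hB, hC, hDn, hLY, hdd] at q
    simp only [sum_map, Fin.castAddEmb_apply, Fin.val_castAdd] at q
    exact (hQσ q).imp (fun h => by linarith only [h]) fun h => by linarith only [h]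
  have hQc : ∀ (H : Finset (Fin J)) (k : Fin J), 1 ≤ (k : ℕ) →
      D ≤ A + B + C - (1 - dc) + ∑ j ∈ H, ((j : ℕ) : ℝ) * γ (Fin.castAdd e j) + σ ∨
        D ≤ A + B + C - (∑ j ∈ H, γ (Fin.castAdd e j) + α (Fin.castAdd e k) + β (Fin.castAdd e k)) + σ := by
    intro H k hk
    have hq' := hQZ hc₁ hc₂ hc₃ X Y Z hX hY hZ hTX hTY hTZ hD (H.map (Fin.castAddEmb e)) (Fin.castAdd e k)
      (hcast1 hk)
    rw [← mul_rotate (subBox (H.map (Fin.castAddEmb e)) Z).card] at hq'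
    have q := sqrtLattice_linear hc₃ hZ hX hY hDτ hΛ hBr (H.map (Fin.castAddEmb e)) (Fin.castAdd e k) hq'
    rw [hα, hβ, hγ, hA, hB, hC, hDn, hLZ, hdd] at q
    simp only [sum_map, Fin.castAddEmb_apply, Fin.val_castAdd] at q
    exact (hQσ q).imp (fun h => by linarith only [h]) fun h => by linarith only [h]
  /- the DE family (`dispersion_linear` fed by `de_dispersionToolX` / `de_dispersionToolZ`): hosts `x`, `y` (tool X on the
  swapped datum), `z`; pivots `Fin.castAdd e i₀`, `Fin.castAdd e i₁`, level set mapped along `Fin.castAdd e`; the halved loss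
  `((6d+8) log Dτ + log 4400 + 3 log 4) / 2 ≤ σ` -/
  have hK1 : (1 : ℝ) ≤ 4400 := by norm_num
  have hloss : Real.logb Λ 4400 + (6 * ((J : ℝ) + (e : ℝ)) + 8) * Real.logb Λ Dτ + 3 * Real.logb Λ 4 ≤ 2 * σ := by
    have e1 : Real.logb Λ 4400 + 3 * Real.logb Λ 4 = Real.logb Λ 281600 := by
      rw [show (281600 : ℝ) = 4400 * 4 ^ 3 by norm_num, Real.logb_mul (by norm_num) (by norm_num), Real.logb_pow]
      push_cast; ring
    have e2 : 2 * (Real.logb Λ 27 + Real.logb Λ 48) = Real.logb Λ 1679616 := by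
      rw [show (1679616 : ℝ) = (27 * 48) ^ 2 by norm_num, Real.logb_pow, Real.logb_mul (by norm_num) (by norm_num)]
      push_cast; ring
    have e3 : Real.logb Λ 281600 ≤ Real.logb Λ 1679616 := Real.logb_le_logb_of_le hΛ (by norm_num) (by norm_num)
    have e4 : (6 * ((J : ℝ) + (e : ℝ)) + 8) * Real.logb Λ Dτ ≤ (24 * ((J : ℝ) + e) + 6 * J + 20) * Real.logb Λ Dτ :=
      mul_le_mul_of_nonneg_right (by linarith only [he0, hJ1]) hlD0
    linarith only [e1, e2, e3, e4, hσ', hK20, hlV0, hl114, hl24, hlP0, hmax0]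
  /- host `x` -/
  have hDEa : ∀ (i₀ i₁ : Fin J), (i₀ : ℕ) = 0 → (i₁ : ℕ) = 1 → ∀ (Q : Finset (Fin J)),
        D ≤ ((β (Fin.castAdd e i₀) + γ (Fin.castAdd e i₀)) + 0 + ∑ j ∈ Q, α (Fin.castAdd e j) + (∑ j ∈ Q, α (Fin.castAdd e j) + 2 * ((B - β (Fin.castAdd e i₀) - β (Fin.castAdd e i₁)) + (C - γ (Fin.castAdd e i₀) - γ (Fin.castAdd e i₁))) + 2 * (β (Fin.castAdd e i₁) + γ (Fin.castAdd e i₁)) - ∑ j ∈ Q, (((j : ℕ) : ℝ) + 1) * α (Fin.castAdd e j))) / 2 + σ ∨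
        D ≤ ((β (Fin.castAdd e i₀) + γ (Fin.castAdd e i₀)) + 0 + ∑ j ∈ Q, α (Fin.castAdd e j) + (∑ j ∈ Q, α (Fin.castAdd e j) + 2 * ((B - β (Fin.castAdd e i₀) - β (Fin.castAdd e i₁)) + (C - γ (Fin.castAdd e i₀) - γ (Fin.castAdd e i₁))))) / 2 + σ ∨
        D ≤ ((β (Fin.castAdd e i₀) + γ (Fin.castAdd e i₀)) + 0 + ∑ j ∈ Q, α (Fin.castAdd e j) + ((β (Fin.castAdd e i₁) + γ (Fin.castAdd e i₁)) + ∑ j ∈ Q, α (Fin.castAdd e j) + ((B - β (Fin.castAdd e i₀) - β (Fin.castAdd e i₁)) + (C - γ (Fin.castAdd e i₀) - γ (Fin.castAdd e i₁))))) / 2 + σ ∨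
        D ≤ ((β (Fin.castAdd e i₀) + γ (Fin.castAdd e i₀)) + 0 + ∑ j ∈ Q, α (Fin.castAdd e j) + ((β (Fin.castAdd e i₁) + γ (Fin.castAdd e i₁)) + 2 * ((B - β (Fin.castAdd e i₀) - β (Fin.castAdd e i₁)) + (C - γ (Fin.castAdd e i₀) - γ (Fin.castAdd e i₁))) + (∑ j ∈ Q, α (Fin.castAdd e j)) / 2)) / 2 + σ ∨
        D ≤ ((β (Fin.castAdd e i₀) + γ (Fin.castAdd e i₀)) + ((β (Fin.castAdd e i₀) + γ (Fin.castAdd e i₀)) - ∑ j ∈ Q, (((j : ℕ) : ℝ) + 1) * α (Fin.castAdd e j)) + ∑ j ∈ Q, α (Fin.castAdd e j) + (∑ j ∈ Q, α (Fin.castAdd e j) + 2 * ((B - β (Fin.castAdd e i₀) - β (Fin.castAdd e i₁)) + (C - γ (Fin.castAdd e i₀) - γ (Fin.castAdd e i₁))) + 2 * (β (Fin.castAdd e i₁) + γ (Fin.castAdd e i₁)) - ∑ j ∈ Q, (((j : ℕ) : ℝ) + 1) * α (Fin.castAdd e j))) / 2 + σ ∨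
        D ≤ ((β (Fin.castAdd e i₀) + γ (Fin.castAdd e i₀)) + ((β (Fin.castAdd e i₀) + γ (Fin.castAdd e i₀)) - ∑ j ∈ Q, (((j : ℕ) : ℝ) + 1) * α (Fin.castAdd e j)) + ∑ j ∈ Q, α (Fin.castAdd e j) + (∑ j ∈ Q, α (Fin.castAdd e j) + 2 * ((B - β (Fin.castAdd e i₀) - β (Fin.castAdd e i₁)) + (C - γ (Fin.castAdd e i₀) - γ (Fin.castAdd e i₁))))) / 2 + σ ∨
        D ≤ ((β (Fin.castAdd e i₀) + γ (Fin.castAdd e i₀)) + ((β (Fin.castAdd e i₀) + γ (Fin.castAdd e i₀)) - ∑ j ∈ Q, (((j : ℕ) : ℝ) + 1) * α (Fin.castAdd e j)) + ∑ j ∈ Q, α (Fin.castAdd e j) + ((β (Fin.castAdd e i₁) + γ (Fin.castAdd e i₁)) + ∑ j ∈ Q, α (Fin.castAdd e j) + ((B - β (Fin.castAdd e i₀) - β (Fin.castAdd e i₁)) + (C - γ (Fin.castAdd e i₀) - γ (Fin.castAdd e i₁))))) / 2 + σ ∨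
        D ≤ ((β (Fin.castAdd e i₀) + γ (Fin.castAdd e i₀)) + ((β (Fin.castAdd e i₀) + γ (Fin.castAdd e i₀)) - ∑ j ∈ Q, (((j : ℕ) : ℝ) + 1) * α (Fin.castAdd e j)) + ∑ j ∈ Q, α (Fin.castAdd e j) + ((β (Fin.castAdd e i₁) + γ (Fin.castAdd e i₁)) + 2 * ((B - β (Fin.castAdd e i₀) - β (Fin.castAdd e i₁)) + (C - γ (Fin.castAdd e i₀) - γ (Fin.castAdd e i₁))) + (∑ j ∈ Q, α (Fin.castAdd e j)) / 2)) / 2 + σ := by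
    intro i₀ i₁ h0 h1 Q
    have hv0 : ((Fin.castAdd e i₀ : Fin (J + e)) : ℕ) = 0 := by rw [Fin.val_castAdd, h0]
    have hv1 : ((Fin.castAdd e i₁ : Fin (J + e)) : ℕ) = 1 := by rw [Fin.val_castAdd, h1]
    have hne : (Fin.castAdd e i₀ : Fin (J + e)) ≠ Fin.castAdd e i₁ := fun h => by
      have h' := congrArg Fin.val h; rw [hv0, hv1] at h'; exact absurd h' (by norm_num)
    have htool := de_dispersionToolX (Fin.castAdd e i₀) (Fin.castAdd e i₁) hv0 hv1 hc₁ hc₂ hc₃ X Y Z hX hY hZ hTX hTY hTZ hD8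
      (Q.map (Fin.castAddEmb e))
    have h := dispersion_linear hX hY hZ hDτ hΛ hBr hK1 (6 * (J + e) + 8) (Q.map (Fin.castAddEmb e))
      (Fin.castAdd e i₀) (Fin.castAdd e i₁) hne htool
    rw [hα, hβ, hγ] at h
    simp only [hB, hC, hDn, sum_map, Fin.castAddEmb_apply, Fin.val_castAdd] at h
    push_cast at h
    rcases h with h | h | h | h | h | h | h | h
    · exact Or.inl (by linarith only [h, hloss])
    · exact Or.inr (Or.inl (by linarith only [h, hloss]))
    · exact Or.inr (Or.inr (Or.inl (by linarith only [h, hloss])))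
    · exact Or.inr (Or.inr (Or.inr (Or.inl (by linarith only [h, hloss]))))
    · exact Or.inr (Or.inr (Or.inr (Or.inr (Or.inl (by linarith only [h, hloss])))))
    · exact Or.inr (Or.inr (Or.inr (Or.inr (Or.inr (Or.inl (by linarith only [h, hloss]))))))
    · exact Or.inr (Or.inr (Or.inr (Or.inr (Or.inr (Or.inr (Or.inl (by linarith only [h, hloss])))))))
    · exact Or.inr (Or.inr (Or.inr (Or.inr (Or.inr (Or.inr (Or.inr (by linarith only [h, hloss])))))))
  /- host `y`: the X-tool on the swapped datum `(c₂, c₁, c₃; Y, X, Z)` -/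
  have hDEb : ∀ (i₀ i₁ : Fin J), (i₀ : ℕ) = 0 → (i₁ : ℕ) = 1 → ∀ (Q : Finset (Fin J)),
        D ≤ ((α (Fin.castAdd e i₀) + γ (Fin.castAdd e i₀)) + 0 + ∑ j ∈ Q, β (Fin.castAdd e j) + (∑ j ∈ Q, β (Fin.castAdd e j) + 2 * ((A - α (Fin.castAdd e i₀) - α (Fin.castAdd e i₁)) + (C - γ (Fin.castAdd e i₀) - γ (Fin.castAdd e i₁))) + 2 * (α (Fin.castAdd e i₁) + γ (Fin.castAdd e i₁)) - ∑ j ∈ Q, (((j : ℕ) : ℝ) + 1) * β (Fin.castAdd e j))) / 2 + σ ∨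
        D ≤ ((α (Fin.castAdd e i₀) + γ (Fin.castAdd e i₀)) + 0 + ∑ j ∈ Q, β (Fin.castAdd e j) + (∑ j ∈ Q, β (Fin.castAdd e j) + 2 * ((A - α (Fin.castAdd e i₀) - α (Fin.castAdd e i₁)) + (C - γ (Fin.castAdd e i₀) - γ (Fin.castAdd e i₁))))) / 2 + σ ∨
        D ≤ ((α (Fin.castAdd e i₀) + γ (Fin.castAdd e i₀)) + 0 + ∑ j ∈ Q, β (Fin.castAdd e j) + ((α (Fin.castAdd e i₁) + γ (Fin.castAdd e i₁)) + ∑ j ∈ Q, β (Fin.castAdd e j) + ((A - α (Fin.castAdd e i₀) - α (Fin.castAdd e i₁)) + (C - γ (Fin.castAdd e i₀) - γ (Fin.castAdd e i₁))))) / 2 + σ ∨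
        D ≤ ((α (Fin.castAdd e i₀) + γ (Fin.castAdd e i₀)) + 0 + ∑ j ∈ Q, β (Fin.castAdd e j) + ((α (Fin.castAdd e i₁) + γ (Fin.castAdd e i₁)) + 2 * ((A - α (Fin.castAdd e i₀) - α (Fin.castAdd e i₁)) + (C - γ (Fin.castAdd e i₀) - γ (Fin.castAdd e i₁))) + (∑ j ∈ Q, β (Fin.castAdd e j)) / 2)) / 2 + σ ∨
        D ≤ ((α (Fin.castAdd e i₀) + γ (Fin.castAdd e i₀)) + ((α (Fin.castAdd e i₀) + γ (Fin.castAdd e i₀)) - ∑ j ∈ Q, (((j : ℕ) : ℝ) + 1) * β (Fin.castAdd e j)) + ∑ j ∈ Q, β (Fin.castAdd e j) + (∑ j ∈ Q, β (Fin.castAdd e j) + 2 * ((A - α (Fin.castAdd e i₀) - α (Fin.castAdd e i₁)) + (C - γ (Fin.castAdd e i₀) - γ (Fin.castAdd e i₁))) + 2 * (α (Fin.castAdd e i₁) + γ (Fin.castAdd e i₁)) - ∑ j ∈ Q, (((j : ℕ) : ℝ) + 1) * β (Fin.castAdd e j))) / 2 + σ ∨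
        D ≤ ((α (Fin.castAdd e i₀) + γ (Fin.castAdd e i₀)) + ((α (Fin.castAdd e i₀) + γ (Fin.castAdd e i₀)) - ∑ j ∈ Q, (((j : ℕ) : ℝ) + 1) * β (Fin.castAdd e j)) + ∑ j ∈ Q, β (Fin.castAdd e j) + (∑ j ∈ Q, β (Fin.castAdd e j) + 2 * ((A - α (Fin.castAdd e i₀) - α (Fin.castAdd e i₁)) + (C - γ (Fin.castAdd e i₀) - γ (Fin.castAdd e i₁))))) / 2 + σ ∨
        D ≤ ((α (Fin.castAdd e i₀) + γ (Fin.castAdd e i₀)) + ((α (Fin.castAdd e i₀) + γ (Fin.castAdd e i₀)) - ∑ j ∈ Q, (((j : ℕ) : ℝ) + 1) * β (Fin.castAdd e j)) + ∑ j ∈ Q, β (Fin.castAdd e j) + ((α (Fin.castAdd e i₁) + γ (Fin.castAdd e i₁)) + ∑ j ∈ Q, β (Fin.castAdd e j) + ((A - α (Fin.castAdd e i₀) - α (Fin.castAdd e i₁)) + (C - γ (Fin.castAdd e i₀) - γ (Fin.castAdd e i₁))))) / 2 + σ ∨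
        D ≤ ((α (Fin.castAdd e i₀) + γ (Fin.castAdd e i₀)) + ((α (Fin.castAdd e i₀) + γ (Fin.castAdd e i₀)) - ∑ j ∈ Q, (((j : ℕ) : ℝ) + 1) * β (Fin.castAdd e j)) + ∑ j ∈ Q, β (Fin.castAdd e j) + ((α (Fin.castAdd e i₁) + γ (Fin.castAdd e i₁)) + 2 * ((A - α (Fin.castAdd e i₀) - α (Fin.castAdd e i₁)) + (C - γ (Fin.castAdd e i₀) - γ (Fin.castAdd e i₁))) + (∑ j ∈ Q, β (Fin.castAdd e j)) / 2)) / 2 + σ := by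
    intro i₀ i₁ h0 h1 Q
    have hv0 : ((Fin.castAdd e i₀ : Fin (J + e)) : ℕ) = 0 := by rw [Fin.val_castAdd, h0]
    have hv1 : ((Fin.castAdd e i₁ : Fin (J + e)) : ℕ) = 1 := by rw [Fin.val_castAdd, h1]
    have hne : (Fin.castAdd e i₀ : Fin (J + e)) ≠ Fin.castAdd e i₁ := fun h => by
      have h' := congrArg Fin.val h; rw [hv0, hv1] at h'; exact absurd h' (by norm_num)
    have htool := de_dispersionToolX (Fin.castAdd e i₀) (Fin.castAdd e i₁) hv0 hv1 hc₂ hc₁ hc₃ Y X Z hY hX hZ hTY hTX hTZ hD8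
      (Q.map (Fin.castAddEmb e))
    rw [← shapeCount_swap c₁ c₂ c₃ X Y Z] at htool
    have h := dispersion_linear hY hX hZ hDτ hΛ hBr hK1 (6 * (J + e) + 8) (Q.map (Fin.castAddEmb e))
      (Fin.castAdd e i₀) (Fin.castAdd e i₁) hne htool
    rw [hα, hβ, hγ] at h
    simp only [hA, hC, hDn, sum_map, Fin.castAddEmb_apply, Fin.val_castAdd] at h
    push_cast at h
    rcases h with h | h | h | h | h | h | h | h
    · exact Or.inl (by linarith only [h, hloss])
    · exact Or.inr (Or.inl (by linarith only [h, hloss]))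
    · exact Or.inr (Or.inr (Or.inl (by linarith only [h, hloss])))
    · exact Or.inr (Or.inr (Or.inr (Or.inl (by linarith only [h, hloss]))))
    · exact Or.inr (Or.inr (Or.inr (Or.inr (Or.inl (by linarith only [h, hloss])))))
    · exact Or.inr (Or.inr (Or.inr (Or.inr (Or.inr (Or.inl (by linarith only [h, hloss]))))))
    · exact Or.inr (Or.inr (Or.inr (Or.inr (Or.inr (Or.inr (Or.inl (by linarith only [h, hloss])))))))
    · exact Or.inr (Or.inr (Or.inr (Or.inr (Or.inr (Or.inr (Or.inr (by linarith only [h, hloss])))))))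
  /- host `z` -/
  have hDEc : ∀ (i₀ i₁ : Fin J), (i₀ : ℕ) = 0 → (i₁ : ℕ) = 1 → ∀ (Q : Finset (Fin J)),
        D ≤ ((α (Fin.castAdd e i₀) + β (Fin.castAdd e i₀)) + 0 + ∑ j ∈ Q, γ (Fin.castAdd e j) + (∑ j ∈ Q, γ (Fin.castAdd e j) + 2 * ((A - α (Fin.castAdd e i₀) - α (Fin.castAdd e i₁)) + (B - β (Fin.castAdd e i₀) - β (Fin.castAdd e i₁))) + 2 * (α (Fin.castAdd e i₁) + β (Fin.castAdd e i₁)) - ∑ j ∈ Q, (((j : ℕ) : ℝ) + 1) * γ (Fin.castAdd e j))) / 2 + σ ∨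
        D ≤ ((α (Fin.castAdd e i₀) + β (Fin.castAdd e i₀)) + 0 + ∑ j ∈ Q, γ (Fin.castAdd e j) + (∑ j ∈ Q, γ (Fin.castAdd e j) + 2 * ((A - α (Fin.castAdd e i₀) - α (Fin.castAdd e i₁)) + (B - β (Fin.castAdd e i₀) - β (Fin.castAdd e i₁))))) / 2 + σ ∨
        D ≤ ((α (Fin.castAdd e i₀) + β (Fin.castAdd e i₀)) + 0 + ∑ j ∈ Q, γ (Fin.castAdd e j) + ((α (Fin.castAdd e i₁) + β (Fin.castAdd e i₁)) + ∑ j ∈ Q, γ (Fin.castAdd e j) + ((A - α (Fin.castAdd e i₀) - α (Fin.castAdd e i₁)) + (B - β (Fin.castAdd e i₀) - β (Fin.castAdd e i₁))))) / 2 + σ ∨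
        D ≤ ((α (Fin.castAdd e i₀) + β (Fin.castAdd e i₀)) + 0 + ∑ j ∈ Q, γ (Fin.castAdd e j) + ((α (Fin.castAdd e i₁) + β (Fin.castAdd e i₁)) + 2 * ((A - α (Fin.castAdd e i₀) - α (Fin.castAdd e i₁)) + (B - β (Fin.castAdd e i₀) - β (Fin.castAdd e i₁))) + (∑ j ∈ Q, γ (Fin.castAdd e j)) / 2)) / 2 + σ ∨
        D ≤ ((α (Fin.castAdd e i₀) + β (Fin.castAdd e i₀)) + ((α (Fin.castAdd e i₀) + β (Fin.castAdd e i₀)) - ∑ j ∈ Q, (((j : ℕ) : ℝ) + 1) * γ (Fin.castAdd e j)) + ∑ j ∈ Q, γ (Fin.castAdd e j) + (∑ j ∈ Q, γ (Fin.castAdd e j) + 2 * ((A - α (Fin.castAdd e i₀) - α (Fin.castAdd e i₁)) + (B - β (Fin.castAdd e i₀) - β (Fin.castAdd e i₁))) + 2 * (α (Fin.castAdd e i₁) + β (Fin.castAdd e i₁)) - ∑ j ∈ Q, (((j : ℕ) : ℝ) + 1) * γ (Fin.castAdd e j))) / 2 + σ ∨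
        D ≤ ((α (Fin.castAdd e i₀) + β (Fin.castAdd e i₀)) + ((α (Fin.castAdd e i₀) + β (Fin.castAdd e i₀)) - ∑ j ∈ Q, (((j : ℕ) : ℝ) + 1) * γ (Fin.castAdd e j)) + ∑ j ∈ Q, γ (Fin.castAdd e j) + (∑ j ∈ Q, γ (Fin.castAdd e j) + 2 * ((A - α (Fin.castAdd e i₀) - α (Fin.castAdd e i₁)) + (B - β (Fin.castAdd e i₀) - β (Fin.castAdd e i₁))))) / 2 + σ ∨
        D ≤ ((α (Fin.castAdd e i₀) + β (Fin.castAdd e i₀)) + ((α (Fin.castAdd e i₀) + β (Fin.castAdd e i₀)) - ∑ j ∈ Q, (((j : ℕ) : ℝ) + 1) * γ (Fin.castAdd e j)) + ∑ j ∈ Q, γ (Fin.castAdd e j) + ((α (Fin.castAdd e i₁) + β (Fin.castAdd e i₁)) + ∑ j ∈ Q, γ (Fin.castAdd e j) + ((A - α (Fin.castAdd e i₀) - α (Fin.castAdd e i₁)) + (B - β (Fin.castAdd e i₀) - β (Fin.castAdd e i₁))))) / 2 + σ ∨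
        D ≤ ((α (Fin.castAdd e i₀) + β (Fin.castAdd e i₀)) + ((α (Fin.castAdd e i₀) + β (Fin.castAdd e i₀)) - ∑ j ∈ Q, (((j : ℕ) : ℝ) + 1) * γ (Fin.castAdd e j)) + ∑ j ∈ Q, γ (Fin.castAdd e j) + ((α (Fin.castAdd e i₁) + β (Fin.castAdd e i₁)) + 2 * ((A - α (Fin.castAdd e i₀) - α (Fin.castAdd e i₁)) + (B - β (Fin.castAdd e i₀) - β (Fin.castAdd e i₁))) + (∑ j ∈ Q, γ (Fin.castAdd e j)) / 2)) / 2 + σ := by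
    intro i₀ i₁ h0 h1 Q
    have hv0 : ((Fin.castAdd e i₀ : Fin (J + e)) : ℕ) = 0 := by rw [Fin.val_castAdd, h0]
    have hv1 : ((Fin.castAdd e i₁ : Fin (J + e)) : ℕ) = 1 := by rw [Fin.val_castAdd, h1]
    have hne : (Fin.castAdd e i₀ : Fin (J + e)) ≠ Fin.castAdd e i₁ := fun h => by
      have h' := congrArg Fin.val h; rw [hv0, hv1] at h'; exact absurd h' (by norm_num)
    have htool := de_dispersionToolZ (Fin.castAdd e i₀) (Fin.castAdd e i₁) hv0 hv1 hc₁ hc₂ hc₃ X Y Z hX hY hZ hTX hTY hTZ hD8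
      (Q.map (Fin.castAddEmb e))
    have h := dispersion_linear hZ hX hY hDτ hΛ hBr hK1 (6 * (J + e) + 8) (Q.map (Fin.castAddEmb e))
      (Fin.castAdd e i₀) (Fin.castAdd e i₁) hne htool
    rw [hα, hβ, hγ] at h
    simp only [hA, hB, hDn, sum_map, Fin.castAddEmb_apply, Fin.val_castAdd] at h
    push_cast at h
    rcases h with h | h | h | h | h | h | h | h
    · exact Or.inl (by linarith only [h, hloss])
    · exact Or.inr (Or.inl (by linarith only [h, hloss]))
    · exact Or.inr (Or.inr (Or.inl (by linarith only [h, hloss])))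
    · exact Or.inr (Or.inr (Or.inr (Or.inl (by linarith only [h, hloss]))))
    · exact Or.inr (Or.inr (Or.inr (Or.inr (Or.inl (by linarith only [h, hloss])))))
    · exact Or.inr (Or.inr (Or.inr (Or.inr (Or.inr (Or.inl (by linarith only [h, hloss]))))))
    · exact Or.inr (Or.inr (Or.inr (Or.inr (Or.inr (Or.inr (Or.inl (by linarith only [h, hloss])))))))
    · exact Or.inr (Or.inr (Or.inr (Or.inr (Or.inr (Or.inr (Or.inr (by linarith only [h, hloss])))))))
  /- the linear programme -/
  rw [hDn]
  exact hlp (fun k => α (Fin.castAdd e k)) (fun k => β (Fin.castAdd e k)) (fun k => γ (Fin.castAdd e k)) A B C D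
    da db dc σ (fun k => hα0 (Fin.castAdd e k)) (fun k => hβ0 (Fin.castAdd e k)) (fun k => hγ0 (Fin.castAdd e k))
    hTa hTb hTc hWa hda0 hda1 hWb hdb0 hdb1 hWc hdc0 hdcσ hσ0 hσm hL h_T_ab h_T_ac h_T_bc hDt hF hG hQa hQb hQc hDEa hDEb hDEc

end Summit.ABC.ABC.Theorems.MazurKaneLaw

end
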